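import Summits.Ventures.Crystal3D.Theorems.StickyWulffConstantPolycrystalWulffBoundColumnarChimera
import Summits.Ventures.Crystal3D.Theorems.StickyWulffConstantPolycrystalWulffBoundMinkowskiUpper
import Summits.Ventures.Crystal3D.Theorems.StickyWulffConstantPolycrystalWulffBoundPolyClosure
import Summits.Ventures.Crystal3D.Theorems.StickyWulffConstantPolycrystalWulffBoundSeparated

/-!
# `PolycrystalWulffBound`, line `PolyDensity`: the rung `rung_columnar` — COLUMNAR single-axis twin
# textures (all twin walls vertical, any azimuths) satisfy the polycrystal Wulff bound (FREE energy alone)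

Route `StickyWulffConstant` of the venture `Summits/Ventures/Crystal3D`, crux `PolycrystalWulffBound`
(item `stmt-Ventures-19482`), second prover lane (poly-p2, gen 8).  COLUMNAR TEXTURES: polyhedral grains
(pairwise disjoint, finite volume), frames pairwise satisfying the crux's clause `Ax m` (one twin axis `m`),
and the COLUMN CONDITION «`x ∈ G_f`, `x + t·m ∈ G_g ⇒ A_f Λ₀ = A_g Λ₀`» — the lattice is constant along
every vertical line, i.e. every twin wall is VERTICAL (contains `m`), of arbitrary and mixed azimuths,
planar or curved: radial fans of incoherent Σ3 `{112}`/`{110}` walls, prismatic twin colonies, the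
single-azimuth lamellae of `rung_verticalLamellar`/`rung_vertical` (special cases).  CONCLUSION: the
FREE energy alone obeys `Fr ≥ 6·2^{1/3}(√2·Vol)^{2/3}`:
* `rung_columnar` (let-vocabulary, free energy) and **`rung_columnar_texture`** (crux `Tex`/`En`
  vocabulary, arbitrary wall data).
Proof: `columnar_chimera_lower` (fibre chimera Brunn–Minkowski with VERTICAL fibres — `R_m` reverses each
fibre in place) + g3's Minkowski-content upper bound `volume_chimera_texture_le`.
With `rung_zone`/`rung_basalLamellar` this exhausts the charge-free classes of the slice-coupling method
(seat memo P-TWIN-g8.md): lattice a function of `(⟪x,m⟫, ⟪x,u⟫)` for `u` a horizontal bond (zone), or of the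
horizontal projection (columnar).  Basal + vertical MIXED (e.g. the W_min centre-cone competitor, whose
free energy IS below the bound) is neither.
WHAT THIS IS NOT: a registered stub; inclined or basal-plus-vertical walls; the crux is not claimed. -/

noncomputable section

open scoped BigOperators InnerProductSpace ENNReal Pointwise
open MeasureTheory Filter Set

namespace Summit.Ventures.Crystal3D.Cruxes.PolycrystalWulffBound.PolyDensity

open Summit.Ventures.Crystal3D.Theorems
open Summit.Ventures.Crystal3D.Cruxes.TextureLiminf.TexShadow (per polytope E3)
open Literature.MathematicalPhysics.StatisticalMechanics (fccStacking barlowStacking IsHaggSeq perimeter)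

/-- **Rung `rung_columnar`** (let-vocabulary of the planner's rungs): COLUMNAR single-axis twin textures
of polyhedral grains (lattice constant along every vertical line: all twin walls vertical, any azimuths)
satisfy the polycrystal Wulff bound with the FREE energy alone. -/
theorem rung_columnar : let Λ : Set (EuclideanSpace ℝ (Fin 3)) := Literature.MathematicalPhysics.StatisticalMechanics.fccStacking 1 (Real.sqrt (2 / 3)); let Brl : (ℤ → ℤ) → Set (EuclideanSpace ℝ (Fin 3)) := Literature.MathematicalPhysics.StatisticalMechanics.barlowStacking 1 (Real.sqrt (2 / 3)); let Ax : EuclideanSpace ℝ (Fin 3) → (EuclideanSpace ℝ (Fin 3) ≃ₗᵢ[ℝ] EuclideanSpace ℝ (Fin 3)) → (EuclideanSpace ℝ (Fin 3) ≃ₗᵢ[ℝ] EuclideanSpace ℝ (Fin 3)) → Prop := fun m A B => ∃ (L : EuclideanSpace ℝ (Fin 3) ≃ₗᵢ[ℝ] EuclideanSpace ℝ (Fin 3)) (s₁ s₂ : EuclideanSpace ℝ (Fin 3)) (σ σ' : ℤ → ℤ), Literature.MathematicalPhysics.StatisticalMechanics.IsHaggSeq σ ∧ Literature.MathematicalPhysics.StatisticalMechanics.IsHaggSeq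 σ' ∧ L (EuclideanSpace.single (2 : Fin 3) (1 : ℝ)) = m ∧ A '' Λ ⊆ (fun q => L q + s₁) '' Brl σ ∧ B '' Λ ⊆ (fun q => L q + s₂) '' Brl σ'; let Φ : EuclideanSpace ℝ (Fin 3) → ℝ := fun ν => Real.sqrt 2 / 4 * ∑ᶠ w ∈ {w ∈ Λ | ‖w‖ = 1}, |⟪w, ν⟫_ℝ|; let Per : Set (EuclideanSpace ℝ (Fin 3)) → Set (EuclideanSpace ℝ (Fin 3)) → ℝ := fun K S => (⨆ (ξ : EuclideanSpace ℝ (Fin 3) → EuclideanSpace ℝ (Fin 3)) (_ : ContDiff ℝ 1 ξ ∧ HasCompactSupport ξ ∧ ∀ z, ξ z ∈ K), ENNReal.ofReal (∫ z in S, Literature.MathematicalPhysics.StatisticalMechanics.fieldDivergence ξ z)).toReal; let ι : Set (EuclideanSpace ℝ (Fin 3)) → Set (EuclideanSpace ℝ (Fin 3)) → Set (EuclideanSpace ℝ (Fin 3)) → ℝ := fun K S₁ S₂ => (Per K S₁ + Per K S₂ - Per K (S₁ ∪ S₂)) / 2; let W : (EuclideanSpace ℝ (Fin 3) ≃ₗᵢ[ℝ]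 EuclideanSpace ℝ (Fin 3)) → Set (EuclideanSpace ℝ (Fin 3)) := fun A => {y | ∀ ν : EuclideanSpace ℝ (Fin 3), ⟪y, ν⟫_ℝ ≤ Φ (A.symm ν)}; let Vol : (n : ℕ) → (Fin n → Set (EuclideanSpace ℝ (Fin 3))) → ℝ := fun n G => (volume (⋃ f : Fin n, G f)).toReal; let Poly : Set (EuclideanSpace ℝ (Fin 3)) → Prop := fun S => ∃ (k : ℕ) (H : Fin k → Finset ((EuclideanSpace ℝ (Fin 3)) × ℝ)), S = ⋃ i, ⋂ p ∈ H i, {x | ⟪p.1, x⟫_ℝ < p.2}; let Fr : (n : ℕ) → (Fin n → Set (EuclideanSpace ℝ (Fin 3))) → (Fin n → (EuclideanSpace ℝ (Fin 3) ≃ₗᵢ[ℝ] EuclideanSpace ℝ (Fin 3))) → ℝ := fun n G A => ∑ f : Fin n, Per (W (A f)) (G f) - ∑ f, ∑ g, (if f = g then 0 else ι (W (A f)) (G f) (G g)); ∀ (k : ℕ) (G : Fin k → Set (EuclideanSpace ℝ (Fin 3))) (A : Fin k → (EuclideanSpace ℝ (Fin 3) ≃ₗᵢ[ℝ] EuclideanSpace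 ℝ (Fin 3))) (m u w : EuclideanSpace ℝ (Fin 3)), (∀ f, Poly (G f)) → (∀ f, volume (G f) < ⊤) → (∀ f g, f ≠ g → Disjoint (G f) (G g)) → (∀ f g, Ax m (A f) (A g)) → ‖u‖ = 1 → ‖w‖ = 1 → ⟪u, m⟫_ℝ = 0 → ⟪w, m⟫_ℝ = 0 → ⟪w, u⟫_ℝ = 0 → (∀ f g, ∀ x ∈ G f, ∀ t : ℝ, x + t • m ∈ G g → A f '' Λ = A g '' Λ) → 6 * (2 : ℝ) ^ ((1 : ℝ) / 3) * (Real.sqrt 2 * Vol k G) ^ ((2 : ℝ) / 3) ≤ Fr k G A := by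
  intro Λ Brl Ax Φ Per ι W Vol Poly Fr k G A m u w hPoly hvolG hdisjG hAx hu hw hum hwm hwu hcol
  classical
  show 6 * (2 : ℝ) ^ ((1 : ℝ) / 3) * (Real.sqrt 2 * (volume (⋃ f, G f)).toReal) ^ ((2 : ℝ) / 3) ≤
    (∑ f, Per (W (A f)) (G f)) - ∑ f, ∑ g, (if f = g then 0 else ι (W (A f)) (G f) (G g))
  rw [← Finset.sum_sub_distrib]
  have hPolyG : ∀ f, ∃ (k : ℕ) (H : Fin k → Finset (E3 × ℝ)), G f = ⋃ i, polytope (H i) := hPoly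
  -- bodies
  have hWc : ∀ f, IsCompact (W (A f)) := fun f => isCompact_cruxWulffBody (A f)
  have hWv : ∀ f, Convex ℝ (W (A f)) := fun f => convex_cruxWulffBody (A f)
  have hW0 : ∀ f, (0 : E3) ∈ W (A f) := fun f => zero_mem_cruxWulffBody (A f)
  have hWs : ∀ f, -W (A f) = W (A f) := fun f => neg_cruxWulffBody_eq (A f)
  -- the free energy is nonnegative (`Fr ≥ √3·Per(E')`)
  have hFr0 : 0 ≤ ∑ f, (Per (W (A f)) (G f) - ∑ g, (if f = g then 0 else ι (W (A f)) (G f) (G g))) := by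
    have h := freeEnergy_ge_mul_perimeter G hPolyG hvolG hdisjG (fun f => W (A f)) hWc hWv hW0 hWs
      (Real.sqrt_pos.2 (by norm_num : (0:ℝ) < 3)) (fun f => closedBall_subset_cruxWulffBody (A f))
    exact le_trans (mul_nonneg (Real.sqrt_nonneg 3) ENNReal.toReal_nonneg) h
  set V : ℝ := (volume (⋃ f, G f)).toReal with hV
  have hV0 : 0 ≤ V := ENNReal.toReal_nonneg
  set F : ℝ := ∑ f, (Per (W (A f)) (G f) - ∑ g, (if f = g then 0 else ι (W (A f)) (G f) (G g))) with hF
  -- openness / measurability / finiteness of the grains and of `E' = ⋃ G f`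
  have hGo : ∀ f, IsOpen (G f) := by
    intro f
    obtain ⟨kf, H, hGf⟩ := hPolyG f
    rw [hGf]
    exact isOpen_iUnion fun i => isOpen_biInter_finset fun q _ =>
      isOpen_lt (continuous_const.inner continuous_id) continuous_const
  have hGm : ∀ f, MeasurableSet (G f) := fun f => (hGo f).measurableSet
  have hE'top : volume (⋃ f, G f) ≠ ⊤ := by
    refine (lt_of_le_of_lt (measure_iUnion_le _) ?_).ne
    rw [tsum_fintype]
    exact ENNReal.sum_lt_top.2 fun f _ => hvolG f
  by_cases hE'0 : volume (⋃ f, G f) = 0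
  · -- empty texture: the bound is `0 ≤ Fr`
    have hV00 : V = 0 := by rw [hV, hE'0, ENNReal.toReal_zero]
    rw [hV00, mul_zero, Real.zero_rpow (by norm_num), mul_zero]
    exact hFr0
  -- the grains are bounded, hence so are the chimera neighbourhoods
  have hEbd : Bornology.IsBounded (⋃ f, G f) := by
    refine Bornology.isBounded_iUnion.2 fun f => ?_
    obtain ⟨kf, H, hGf⟩ := hPolyG f
    rw [hGf]
    refine Bornology.isBounded_iUnion.2 fun i => isBounded_hPolyhedron_of_volume_lt_top (H i) ?_
    exact lt_of_le_of_lt (measure_mono (by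
      rw [hGf]; exact subset_iUnion (fun i => ⋂ p ∈ H i, {x : E3 | ⟪p.1, x⟫_ℝ < p.2}) i)) (hvolG f)
  -- the chimera neighbourhood of radius `r`
  have key : ∀ ε : ℝ, 0 < ε → 3 * (32 : ℝ) ^ ((3 : ℝ)⁻¹) * (V ^ ((3 : ℝ)⁻¹)) ^ 2 ≤ F + ε := by
    intro ε hε
    obtain ⟨r₀, hr₀, hup⟩ := volume_chimera_texture_le G hPolyG hvolG hdisjG (fun f => W (A f))
      hWc hWv hW0 hWs hε
    set r : ℝ := r₀ / 2 with hr
    have hr0 : 0 < r := by positivity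
    have hrr₀ : r < r₀ := by rw [hr]; linarith
    set C : Set E3 := ⋃ f, ⋃ x ∈ G f, x +ᵥ (r • W (A f)) with hC
    -- `C` is open (a union of translates of the open grains), hence measurable
    have hCopen : IsOpen C := by
      have hCeq : C = ⋃ f, ⋃ w ∈ r • W (A f), (fun x => x + w) '' G f := by
        ext y
        simp only [hC, mem_iUnion, Set.mem_vadd_set, vadd_eq_add, mem_image, exists_prop]
        constructor
        · rintro ⟨f, x, hx, w, hw, rfl⟩; exact ⟨f, w, hw, x, hx, rfl⟩
        · rintro ⟨f, w, hw, x, hx, rfl⟩; exact ⟨f, x, hx, w, hw, rfl⟩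
      rw [hCeq]
      exact isOpen_iUnion fun f => isOpen_biUnion fun w _ => (isOpenMap_add_right w) _ (hGo f)
    have hCm : MeasurableSet C := hCopen.measurableSet
    -- `C` is bounded, hence of finite volume
    have hCfin : volume C ≠ ⊤ := by
      obtain ⟨R₁, hR₁⟩ := hEbd.subset_closedBall 0
      have hCsub : C ⊆ Metric.closedBall (0 : E3) (R₁ + r * Real.sqrt 5) := by
        intro y hy
        simp only [hC, mem_iUnion, Set.mem_vadd_set, vadd_eq_add, exists_prop] at hy
        obtain ⟨f, x, hx, w, hw, rfl⟩ := hy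
        obtain ⟨w', hw', rfl⟩ := Set.mem_smul_set.1 hw
        have hx' : ‖x‖ ≤ R₁ := mem_closedBall_zero_iff.1 (hR₁ (mem_iUnion.2 ⟨f, hx⟩))
        have hw'' : ‖w'‖ ≤ Real.sqrt 5 := mem_closedBall_zero_iff.1 (cruxWulffBody_subset_closedBall (A f) hw')
        rw [mem_closedBall_zero_iff]
        calc ‖x + r • w'‖ ≤ ‖x‖ + ‖r • w'‖ := norm_add_le _ _
          _ = ‖x‖ + r * ‖w'‖ := by rw [norm_smul, Real.norm_of_nonneg hr0.le]
          _ ≤ R₁ + r * Real.sqrt 5 := by gcongr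
      exact (lt_of_le_of_lt (measure_mono hCsub) measure_closedBall_lt_top).ne
    -- lower bound (chimera) and upper bound (Minkowski content)
    have hlow := columnar_chimera_lower m u w hu hw hum hwm hwu G hGm A hAx hcol hE'0 hE'top hr0 hCm
      (fun f x hx w hw => mem_iUnion.2 ⟨f, mem_iUnion₂.2 ⟨x, hx,
        Set.mem_vadd_set.2 ⟨r • w, Set.smul_mem_smul_set hw, rfl⟩⟩⟩)
    have hupC : (volume C).toReal ≤ V + r * (F + ε) := hup r hr0 hrr₀
    -- to real numbers
    set c : ℝ := (32 : ℝ) ^ ((3 : ℝ)⁻¹) with hc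
    have hc0 : 0 ≤ c := by positivity
    have hexp : (((3 : ℕ) : ℝ)⁻¹) = (3 : ℝ)⁻¹ := by norm_num
    have h1 : V ^ ((3 : ℝ)⁻¹) + r * c ≤ (volume C).toReal ^ ((3 : ℝ)⁻¹) := by
      have h := ENNReal.toReal_mono (ENNReal.rpow_ne_top_of_nonneg (by positivity) hCfin) hlow
      rw [ENNReal.toReal_add (ENNReal.rpow_ne_top_of_nonneg (by positivity) hE'top)
          (ENNReal.mul_ne_top ENNReal.ofReal_ne_top (ENNReal.rpow_ne_top_of_nonneg (by positivity)
            ENNReal.ofReal_ne_top)),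
        ENNReal.toReal_mul, ENNReal.toReal_ofReal hr0.le, ← ENNReal.toReal_rpow, ← ENNReal.toReal_rpow,
        ← ENNReal.toReal_rpow, ENNReal.toReal_ofReal (by norm_num : (0:ℝ) ≤ 32), hexp] at h
      exact h
    -- cube: `(V^{1/3} + r c)³ ≤ |C| ≤ V + r (F + ε)`
    set x : ℝ := V ^ ((3 : ℝ)⁻¹) with hx
    have hx0 : 0 ≤ x := by positivity
    have hx3 : x ^ 3 = V := by
      rw [hx, show ((3 : ℝ)⁻¹) = ((3 : ℕ) : ℝ)⁻¹ by norm_num]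
      exact Real.rpow_inv_natCast_pow hV0 (by norm_num)
    have hC3 : ((volume C).toReal ^ ((3 : ℝ)⁻¹)) ^ 3 = (volume C).toReal := by
      rw [show ((3 : ℝ)⁻¹) = ((3 : ℕ) : ℝ)⁻¹ by norm_num]
      exact Real.rpow_inv_natCast_pow ENNReal.toReal_nonneg (by norm_num)
    have h2 : (x + r * c) ^ 3 ≤ V + r * (F + ε) := by
      calc (x + r * c) ^ 3 ≤ ((volume C).toReal ^ ((3 : ℝ)⁻¹)) ^ 3 := by
            gcongr
        _ = (volume C).toReal := hC3
        _ ≤ V + r * (F + ε) := hupC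
    -- drop the higher-order terms and divide by `r`
    have h3 : r * (3 * c * x ^ 2) ≤ r * (F + ε) := by
      nlinarith [hx3, h2, hx0, hc0, hr0.le, mul_nonneg (mul_nonneg hr0.le hc0) (mul_nonneg hr0.le hc0),
        pow_nonneg (mul_nonneg hr0.le hc0) 3, mul_nonneg hx0 (mul_nonneg (mul_nonneg hr0.le hc0) (mul_nonneg hr0.le hc0))]
    have h4 : 3 * c * x ^ 2 ≤ F + ε := le_of_mul_le_mul_left h3 hr0
    linarith
  rw [wulff_constant_eq hV0]
  exact le_of_forall_pos_le_add key

/-- **Rung `rung_columnar_texture`**: COLUMNAR single-axis twin textures (axis `m₀`; `u, w` any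
horizontal orthonormal pair; lattice constant along every vertical line) satisfy the crux's inequality
`6·2^{1/3}(√2·Vol)^{2/3} ≤ En` for arbitrary wall data. -/
theorem rung_columnar_texture :
    let Λ : Set (EuclideanSpace ℝ (Fin 3)) := Literature.MathematicalPhysics.StatisticalMechanics.fccStacking 1 (Real.sqrt (2 / 3));
    let Brl : (ℤ → ℤ) → Set (EuclideanSpace ℝ (Fin 3)) := Literature.MathematicalPhysics.StatisticalMechanics.barlowStacking 1 (Real.sqrt (2 / 3));
    let Ax : EuclideanSpace ℝ (Fin 3) → (EuclideanSpace ℝ (Fin 3) ≃ₗᵢ[ℝ] EuclideanSpace ℝ (Fin 3)) → (EuclideanSpace ℝ (Fin 3) ≃ₗᵢ[ℝ] EuclideanSpace ℝ (Fin 3)) → Prop := fun m A B => ∃ (L : EuclideanSpace ℝ (Fin 3) ≃ₗᵢ[ℝ] EuclideanSpace ℝ (Fin 3)) (s₁ s₂ : EuclideanSpace ℝ (Fin 3)) (σ σ' : ℤ → ℤ), Literature.MathematicalPhysics.StatisticalMechanics.IsHaggSeq σ ∧ Literature.MathematicalPhysics.StatisticalMechanics.IsHaggSeq σ' ∧ L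 (EuclideanSpace.single (2 : Fin 3) (1 : ℝ)) = m ∧ A '' Λ ⊆ (fun q => L q + s₁) '' Brl σ ∧ B '' Λ ⊆ (fun q => L q + s₂) '' Brl σ';
    let CoAx : (EuclideanSpace ℝ (Fin 3) ≃ₗᵢ[ℝ] EuclideanSpace ℝ (Fin 3)) → (EuclideanSpace ℝ (Fin 3) ≃ₗᵢ[ℝ] EuclideanSpace ℝ (Fin 3)) → Prop := fun A B => ∃ m, Ax m A B;
    let Φ : EuclideanSpace ℝ (Fin 3) → ℝ := fun ν => Real.sqrt 2 / 4 * ∑ᶠ w ∈ {w ∈ Λ | ‖w‖ = 1}, |⟪w, ν⟫_ℝ|;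
    let Per : Set (EuclideanSpace ℝ (Fin 3)) → Set (EuclideanSpace ℝ (Fin 3)) → ℝ := fun K S => (⨆ (ξ : EuclideanSpace ℝ (Fin 3) → EuclideanSpace ℝ (Fin 3)) (_ : ContDiff ℝ 1 ξ ∧ HasCompactSupport ξ ∧ ∀ z, ξ z ∈ K), ENNReal.ofReal (∫ z in S, Literature.MathematicalPhysics.StatisticalMechanics.fieldDivergence ξ z)).toReal;
    let ι : Set (EuclideanSpace ℝ (Fin 3)) → Set (EuclideanSpace ℝ (Fin 3)) → Set (EuclideanSpace ℝ (Fin 3)) → ℝ := fun K S₁ S₂ => (Per K S₁ + Per K S₂ - Per K (S₁ ∪ S₂)) / 2;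
    let W : (EuclideanSpace ℝ (Fin 3) ≃ₗᵢ[ℝ] EuclideanSpace ℝ (Fin 3)) → Set (EuclideanSpace ℝ (Fin 3)) := fun A => {y | ∀ ν : EuclideanSpace ℝ (Fin 3), ⟪y, ν⟫_ℝ ≤ Φ (A.symm ν)};
    let Dsc : EuclideanSpace ℝ (Fin 3) → Set (EuclideanSpace ℝ (Fin 3)) := fun m => {y | ‖y‖ ≤ 1 ∧ ⟪y, m⟫_ℝ = 0};
    let Tex : (n : ℕ) → (Fin n → Set (EuclideanSpace ℝ (Fin 3))) → (Fin n → (EuclideanSpace ℝ (Fin 3) ≃ₗᵢ[ℝ] EuclideanSpace ℝ (Fin 3))) → (Fin n → Fin n → ℝ) → (Fin n → Fin n → EuclideanSpace ℝ (Fin 3)) → Prop := fun n G A c m => (∀ f : Fin n, Literature.MathematicalPhysics.StatisticalMechanics.HasFinitePerimeter (G f) ∧ volume (G f) < ⊤) ∧ (∀ f g, f ≠ g → Disjoint (G f) (G g)) ∧ (∀ f g, f ≠ g → 0 ≤ c f g) ∧ (∀ f g, f ≠ g → ¬ CoAx (A f) (A g) → m f g = 0 ∧ 1 ≤ c f g)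 ∧ (∀ f g, f ≠ g → CoAx (A f) (A g) → A f '' Λ ≠ A g '' Λ → Ax (m f g) (A f) (A g) ∧ 1 / 2 ≤ c f g);
    let En : (n : ℕ) → (Fin n → Set (EuclideanSpace ℝ (Fin 3))) → (Fin n → (EuclideanSpace ℝ (Fin 3) ≃ₗᵢ[ℝ] EuclideanSpace ℝ (Fin 3))) → (Fin n → Fin n → ℝ) → (Fin n → Fin n → EuclideanSpace ℝ (Fin 3)) → ℝ := fun n G A c m => ∑ f : Fin n, Per (W (A f)) (G f) - ∑ f, ∑ g, (if f = g then 0 else ι (W (A f)) (G f) (G g)) + ∑ f, ∑ g, (if f = g then 0 else c f g / 2 * ι (Dsc (m f g)) (G f) (G g));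
    let Vol : (n : ℕ) → (Fin n → Set (EuclideanSpace ℝ (Fin 3))) → ℝ := fun n G => (volume (⋃ f : Fin n, G f)).toReal;
    let Poly : Set (EuclideanSpace ℝ (Fin 3)) → Prop := fun S => ∃ (k : ℕ) (H : Fin k → Finset ((EuclideanSpace ℝ (Fin 3)) × ℝ)), S = ⋃ i, ⋂ p ∈ H i, {x | ⟪p.1, x⟫_ℝ < p.2};
    ∀ (n : ℕ) (G : Fin n → Set (EuclideanSpace ℝ (Fin 3))) (A : Fin n → (EuclideanSpace ℝ (Fin 3) ≃ₗᵢ[ℝ] EuclideanSpace ℝ (Fin 3))) (c : Fin n → Fin n → ℝ) (m : Fin n → Fin n → EuclideanSpace ℝ (Fin 3)), Tex n G A c m → (∀ f, Poly (G f)) → ∀ (m₀ u w : EuclideanSpace ℝ (Fin 3)), (∀ f g, Ax m₀ (A f) (A g)) → ‖u‖ = 1 → ‖w‖ = 1 → ⟪u, m₀⟫_ℝ = 0 → ⟪w, m₀⟫_ℝ = 0 → ⟪w, u⟫_ℝ = 0 → (∀ f g, ∀ x ∈ G f, ∀ t : ℝ, x + t • m₀ ∈ G g → A f '' Λ = A g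 '' Λ) → 6 * (2 : ℝ) ^ ((1 : ℝ) / 3) * (Real.sqrt 2 * Vol n G) ^ ((2 : ℝ) / 3) ≤ En n G A c m := by
  intro Λ Brl Ax CoAx Φ Per ι W Dsc Tex En Vol Poly n G A c m hTex hPoly m₀ u w hAx hu hw hum hwm hwu hcol
  obtain ⟨hfin, hdisj, hc0, -, -⟩ := hTex
  have hvol : ∀ f, volume (G f) < ⊤ := fun f => (hfin f).2
  have hDc : ∀ v : E3, IsCompact (Dsc v) := fun v =>
    Metric.isCompact_of_isClosed_isBounded
      ((isClosed_le continuous_norm continuous_const).inter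
        (isClosed_eq (continuous_id.inner continuous_const) continuous_const))
      (Metric.isBounded_closedBall.subset (cruxDisc_subset_closedBall v))
  -- the wall terms are nonnegative
  have hwalls : 0 ≤ ∑ f, ∑ g, (if f = g then 0 else c f g / 2 * ι (Dsc (m f g)) (G f) (G g)) := by
    refine Finset.sum_nonneg fun f _ => Finset.sum_nonneg fun g _ => ?_
    by_cases hfg : f = g
    · rw [if_pos hfg]
    · rw [if_neg hfg]
      have hnn := iota_nonneg_of_poly G hPoly hvol hdisj (hDc (m f g)) (convex_cruxDisc (m f g))
        (zero_mem_cruxDisc (m f g)) hfg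
      show 0 ≤ c f g / 2 * ((per (Dsc (m f g)) (G f) + per (Dsc (m f g)) (G g) -
        per (Dsc (m f g)) (G f ∪ G g)) / 2)
      exact mul_nonneg (div_nonneg (hc0 f g hfg) zero_le_two) (div_nonneg hnn zero_le_two)
  -- the free-energy rung
  have hFr : 6 * (2 : ℝ) ^ ((1 : ℝ) / 3) * (Real.sqrt 2 * Vol n G) ^ ((2 : ℝ) / 3) ≤
      ∑ f, Per (W (A f)) (G f) - ∑ f, ∑ g, (if f = g then 0 else ι (W (A f)) (G f) (G g)) :=
    rung_columnar n G A m₀ u w hPoly hvol hdisj hAx hu hw hum hwm hwu hcol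
  show 6 * (2 : ℝ) ^ ((1 : ℝ) / 3) * (Real.sqrt 2 * Vol n G) ^ ((2 : ℝ) / 3) ≤
    ∑ f, Per (W (A f)) (G f) - ∑ f, ∑ g, (if f = g then 0 else ι (W (A f)) (G f) (G g)) +
      ∑ f, ∑ g, (if f = g then 0 else c f g / 2 * ι (Dsc (m f g)) (G f) (G g))
  linarith

end Summit.Ventures.Crystal3D.Cruxes.PolycrystalWulffBound.PolyDensity

end
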